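import Literature.AlgebraicGeometry.Motives.HodgeStructureLefschetzGroupPoints
import Literature.AlgebraicGeometry.Motives.HodgeStructureCentralizerDirectSum
import Literature.AlgebraicGeometry.Motives.HodgeStructureProdPolarization
import HarnessLib

/-!
# Milne 1999, Proposition 1.5 on the abstract polarized `ℚ`-Hodge structure: `S(H₁ ⊕ H₂)(ℚ) ⊆ S(H₁)(ℚ) × S(H₂)(ℚ)` for the
# product polarization, with equality iff `Hom(H₁, H₂) = 0 = Hom(H₂, H₁)`; `S(H ⊕ H)(ℚ) = S(H)(ℚ)` diagonally; the product
# involution on `C(H₁) × C(H₂)` ("the involution it defines on `C(A)` is the restriction of the product of the involutions")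

[topic AlgebraicGeometry/Motives]

Layer `Literature/AlgebraicGeometry/Motives`, lane `lit-hodgefound` (Track 2 foundations library; seat `lit-hodgefound-p34`,
generation 18, self-proposed row g18-#4 of `run/shared/lean/pub/lit-hodgefound/SKELETON.md`). THEOREMS ONLY (no definition,
no named fact; net debt `0`). Fourth file of the seat's programme «Milne 1999 §1 on the abstract polarized `ℚ`-Hodge
structure», the GROUP companion of g18-#3 `Motives/HodgeStructureCentralizerDirectSum` (the algebra `C(H₁ ⊕ H₂)`), for
Milne's group `S(H)(ℚ) = Polarization.lefschetzGroup` of g18-#1 `Motives/HodgeStructureLefschetzGroupPoints` (the `g ∈ GL(V)`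
commuting with `E_φ` and preserving the polarization; Milne's `{γ ∈ C(A) | γ†γ = 1}`) and the product polarization
`Q₁.prod Q₂` of the tree (`Motives/HodgeStructureProdPolarization`: `(Q₁ ⊕ Q₂)((v, w), (v', w')) = Q₁(v, v') + Q₂(w, w')`,
Milne's "`D = Σᵢ A₁ × ⋯ × Dᵢ × ⋯ × A_s` is an ample divisor on `A`"). Block-diagonal elements of `GL(V₁ × V₂)` are Mathlib's
`LinearEquiv.prodCongr g₁ g₂`. The torus-level twin (products of period lattices, real points) is p22's
`Kaehler/ComplexTorusLefschetzGroupFiniteProduct` / `…Product` (`lefschetzGroup_pi_eq`) and the `ℂ`-points twin on `H¹(A(ℂ); ℂ)` is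
`Milne1999/LefschetzGroupProducts` (`unitaryCentralizerGroup.prodMulEquiv`) — OTHER carriers, BY NAME, nothing imported.

## The source, verbatim

J. S. Milne, *Lefschetz classes on abelian varieties*, Duke Math. J. **96** (1999) 639–675 [Milne1999LefschetzClasses]
(held `paper:doi-10-1215-s0012-7094-99-09620-5`, author's folios; Duke page ≈ folio + 638):
* §1 p0005 L21–L27 (p. 643): "Moreover, if `Dᵢ` is an ample divisor on `Aᵢ`, `i = 1, …, s`, then
  `D = Σᵢ A₁ × ⋯ × A_{i-1} × Dᵢ × A_{i+1} × ⋯ × A_s` is an ample divisor on `A`, and **the involution it defines on `C(A)` is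
  the restriction of the product of the involutions on the `C(Aᵢ)` defined by the `Dᵢ`.**"
* §1 p0006 L24–L29 (p. 644): "**Proposition 1.5.** Let `A₁, …, A_s` be a set of representatives for the simple isogeny
  factors of `A`, so that there exists an isogeny `A₁^{r₁} × ⋯ × A_s^{r_s} → A` for some `rᵢ > 0`. Any such isogeny induces
  an isomorphism `S(A₁) × ⋯ × S(A_s) → S(A)`, which is independent of the choice of the isogeny. Proof. This is an immediate
  consequence of Proposition 1.1." (Prop. 1.1 = g18-#3: `C(A) ⊂ C(A₁) × ⋯ × C(A_s)`, `=` iff `Hom(Aᵢ, Aⱼ) = 0`; `C(A^r) = C(A)`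
  diagonally.)
* §3 p0016 L16–L17 (p. 654): "**It follows from Proposition 1.5 that `S(A) = S(A^r)`**, and so it suffices to prove the
  statement with `r = 1`."

## What is PROVED (binary direct sums, `ℚ`-points; `r = 2`)

* §0 **the product involution**: `(Q₁ ⊕ Q₂)`-adjoint of a block-diagonal `(c₁, c₂)` is `(c₁†, c₂†)`
  (`Polarization.adjoint_prod_prodMap`, ANY `cᵢ ∈ End_ℚ(Vᵢ)`); hence on `C(H₁ ⊕ H₂) ⊆ C(H₁) × C(H₂)` (g18-#3) the involution of
  the product polarization is the product of the involutions (`Polarization.adjoint_prod_of_mem_centralizer_endAlg_prod`).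
* §1 **`(g₁, g₂) ∈ S(H₁ ⊕ H₂)(ℚ)`, exactly**: `prodCongr_mem_lefschetzGroup_prod_iff` — iff `gᵢ ∈ S(Hᵢ)(ℚ)` and the pair
  intertwines all morphisms between the summands (from g18-#3's `prodMap_mem_centralizer_endAlg_prod_iff` and
  `(Q₁ ⊕ Q₂)`-isometry `⟺` componentwise isometry, `forall_prod_form_prodCongr_iff`).
* §2 **`S(H₁ ⊕ H₂)(ℚ) ⊆ S(H₁)(ℚ) × S(H₂)(ℚ)`**: every `g ∈ S(H₁ ⊕ H₂)(ℚ)` is block diagonal, `g = (g₁, g₂)` with `gᵢ ∈ S(Hᵢ)(ℚ)`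
  its restrictions to the summands (`restrictRetract` of the tree's `MumfordTateGroupDirectSum`; `exists_prodCongr_eq_of_mem_lefschetzGroup_prod`,
  `mem_lefschetzGroup_prod_iff`).
* §3 **Proposition 1.5 for `s = 2`**: `S(H₁)(ℚ) × S(H₂)(ℚ) ⊆ S(H₁ ⊕ H₂)(ℚ)` — equivalently `(g₁, g₂) ↦ g₁ ⊕ g₂` is a bijection
  `S(H₁)(ℚ) × S(H₂)(ℚ) ≅ S(H₁ ⊕ H₂)(ℚ)` — iff `Hom(H₁, H₂) = 0` and `Hom(H₂, H₁) = 0` (`forall_prodCongr_mem_lefschetzGroup_prod_iff`;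
  "⟹" tests `(1, -1)`); `mem_lefschetzGroup_prod_iff_of_hom_eq_zero`, `prodCongr_injective`.
* §4 **"`S(A) = S(A^r)`"** (`r = 2`): `mem_lefschetzGroup_prod_self_iff` — `g ∈ S(H ⊕ H)(ℚ)` iff `g = (g₀, g₀)` diagonal with
  `g₀ ∈ S(H)(ℚ)`; `prodCongr_mem_lefschetzGroup_prod_self_iff`.

NOT here: `K`-points `S(H₁ ⊕ H₂)(K)` (same proof with base-changed idempotents; a later rider), `s > 2`, `r > 2`, the isogeny
clause, "independent of the choice of the isogeny".

## References

* [Milne1999LefschetzClasses] J. S. Milne, *Lefschetz classes on abelian varieties*, Duke Math. J. 96 (1999) 639–675, §1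
  p. 643 (the product divisor and its involution), Proposition 1.5 (p. 644), §3 p. 654 ("S(A) = S(A^r)").
* [Moonen2004MT] B. Moonen, *An introduction to Mumford–Tate groups* (2004), §4 Lemma 4.6 (restriction to a summand).
* [DeligneHodgeII1971] P. Deligne, *Théorie de Hodge II*, Publ. Math. IHÉS 40 (1971), 2.1, 2.1.15.
-/

noncomputable section

namespace Literature.AlgebraicGeometry.Motives

namespace HodgeStructure

universe u

variable {V₁ : Type u} [AddCommGroup V₁] [Module ℚ V₁] {V₂ : Type u} [AddCommGroup V₂] [Module ℚ V₂] {n : ℤ}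
  {H₁ : HodgeStructure V₁ n} {H₂ : HodgeStructure V₂ n} (Q₁ : Polarization H₁) (Q₂ : Polarization H₂)

/-! ## §0 The involution of the product polarization is the product of the involutions -/

section Involution

variable [Module.Finite ℚ V₁] [Module.Finite ℚ V₂]

/-- **"the involution it defines on `C(A)` is the restriction of the product of the involutions on the `C(Aᵢ)`"** — in fact for
ANY block-diagonal operator: the `(Q₁ ⊕ Q₂)`-adjoint of `(c₁, c₂)` is `(c₁†, c₂†)`, since
`(Q₁ ⊕ Q₂)((c₁ v, c₂ w), (v', w')) = Q₁(c₁ v, v') + Q₂(c₂ w, w') = Q₁(v, c₁† v') + Q₂(w, c₂† w')`.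
[cite: Milne1999LefschetzClasses, §1 p. 643 L21–L27] -/
theorem Polarization.adjoint_prod_prodMap (c₁ : Module.End ℚ V₁) (c₂ : Module.End ℚ V₂) :
    (Q₁.prod Q₂).adjoint (LinearMap.prodMap c₁ c₂) = LinearMap.prodMap (Q₁.adjoint c₁) (Q₂.adjoint c₂) := by
  refine ((Q₁.prod Q₂).eq_adjoint_of_isAdjointPair fun x y ↦ ?_).symm
  rw [Polarization.prod_form_apply, Polarization.prod_form_apply, LinearMap.prodMap_apply, LinearMap.prodMap_apply]
  dsimp only
  rw [Q₁.form_apply_adjoint, Q₂.form_apply_adjoint]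

/-- On Milne's `C(H₁ ⊕ H₂)` (block diagonal by g18-#3): the involution of the product polarization acts blockwise by the
involutions of `Q₁`, `Q₂` on the blocks `c₁ = fst ∘ c ∘ inl`, `c₂ = snd ∘ c ∘ inr`. [cite: Milne1999LefschetzClasses, §1 p. 643 L21–L27] -/
theorem Polarization.adjoint_prod_of_mem_centralizer_endAlg_prod {c : Module.End ℚ (V₁ × V₂)}
    (hc : c ∈ Subalgebra.centralizer ℚ ((H₁.prod H₂).endAlg : Set (Module.End ℚ (V₁ × V₂)))) :
    (Q₁.prod Q₂).adjoint c = LinearMap.prodMap (Q₁.adjoint (LinearMap.fst ℚ V₁ V₂ ∘ₗ c ∘ₗ LinearMap.inl ℚ V₁ V₂))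
      (Q₂.adjoint (LinearMap.snd ℚ V₁ V₂ ∘ₗ c ∘ₗ LinearMap.inr ℚ V₁ V₂)) := by
  conv_lhs => rw [eq_prodMap_of_mem_centralizer_endAlg_prod hc]
  exact Q₁.adjoint_prod_prodMap Q₂ _ _

end Involution

/-! ## §1 Block-diagonal elements of `S(H₁ ⊕ H₂)(ℚ)` -/

section Blocks

omit Q₁ Q₂ in
/-- `↑(g₁ ⊕ g₂) = ↑g₁ ⊕ ↑g₂` on the underlying endomorphisms. [folklore] -/
private theorem coe_prodCongr_eq_prodMap (g₁ : V₁ ≃ₗ[ℚ] V₁) (g₂ : V₂ ≃ₗ[ℚ] V₂) :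
    ((g₁.prodCongr g₂ : (V₁ × V₂) ≃ₗ[ℚ] (V₁ × V₂)) : Module.End ℚ (V₁ × V₂)) =
      LinearMap.prodMap (g₁ : Module.End ℚ V₁) (g₂ : Module.End ℚ V₂) := by
  refine LinearMap.ext fun x ↦ ?_
  rw [LinearEquiv.coe_coe, LinearEquiv.prodCongr_apply, LinearMap.prodMap_apply, LinearEquiv.coe_coe, LinearEquiv.coe_coe]

/-- A block-diagonal `(g₁, g₂)` preserves `Q₁ ⊕ Q₂` iff `g₁` preserves `Q₁` and `g₂` preserves `Q₂` (set `w = w' = 0`, resp.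
`v = v' = 0`). [cite: Milne1999LefschetzClasses, §1 p. 643 L21–L27 and Prop. 1.5] -/
theorem Polarization.forall_prod_form_prodCongr_iff (g₁ : V₁ ≃ₗ[ℚ] V₁) (g₂ : V₂ ≃ₗ[ℚ] V₂) :
    (∀ x y : V₁ × V₂, (Q₁.prod Q₂).form (g₁.prodCongr g₂ x) (g₁.prodCongr g₂ y) = (Q₁.prod Q₂).form x y) ↔
      (∀ v v' : V₁, Q₁.form (g₁ v) (g₁ v') = Q₁.form v v') ∧ ∀ w w' : V₂, Q₂.form (g₂ w) (g₂ w') = Q₂.form w w' := by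
  constructor
  · intro h
    refine ⟨fun v v' ↦ ?_, fun w w' ↦ ?_⟩
    · have h1 := h (v, 0) (v', 0)
      simpa [Polarization.prod_form_apply, LinearEquiv.prodCongr_apply] using h1
    · have h2 := h (0, w) (0, w')
      simpa [Polarization.prod_form_apply, LinearEquiv.prodCongr_apply] using h2
  · rintro ⟨h₁, h₂⟩ x y
    simp only [Polarization.prod_form_apply, LinearEquiv.prodCongr_apply, h₁, h₂]

/-- **`(g₁, g₂) ∈ S(H₁ ⊕ H₂)(ℚ)`, exactly** (for the product polarization): iff `g₁ ∈ S(H₁)(ℚ)`, `g₂ ∈ S(H₂)(ℚ)` and the pair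
intertwines every morphism between the summands (`g₂ f = f g₁` for `f : H₁ → H₂`, `g₁ g = g g₂` for `g : H₂ → H₁`) — the
`C`-part is g18-#3's description of `C(H₁ ⊕ H₂)`, the isometry part is componentwise. [cite: Milne1999LefschetzClasses, §1 Prop. 1.5 (p. 644) and Prop. 1.1] -/
theorem Polarization.prodCongr_mem_lefschetzGroup_prod_iff (g₁ : V₁ ≃ₗ[ℚ] V₁) (g₂ : V₂ ≃ₗ[ℚ] V₂) :
    g₁.prodCongr g₂ ∈ (Q₁.prod Q₂).lefschetzGroup ↔
      g₁ ∈ Q₁.lefschetzGroup ∧ g₂ ∈ Q₂.lefschetzGroup ∧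
        (∀ f : Hom H₁ H₂, (g₂ : Module.End ℚ V₂) ∘ₗ f.toLinearMap = f.toLinearMap ∘ₗ (g₁ : Module.End ℚ V₁)) ∧
          ∀ g : Hom H₂ H₁, (g₁ : Module.End ℚ V₁) ∘ₗ g.toLinearMap = g.toLinearMap ∘ₗ (g₂ : Module.End ℚ V₂) := by
  rw [Polarization.mem_lefschetzGroup_iff, Polarization.mem_lefschetzGroup_iff, Polarization.mem_lefschetzGroup_iff,
    forall_endAlg_apply_iff_coe_mem_centralizer_endAlg (H₁.prod H₂), forall_endAlg_apply_iff_coe_mem_centralizer_endAlg H₁,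
    forall_endAlg_apply_iff_coe_mem_centralizer_endAlg H₂, coe_prodCongr_eq_prodMap, prodMap_mem_centralizer_endAlg_prod_iff,
    Q₁.forall_prod_form_prodCongr_iff Q₂]
  tauto

end Blocks

/-! ## §2 `S(H₁ ⊕ H₂)(ℚ) ⊆ S(H₁)(ℚ) × S(H₂)(ℚ)`: block-diagonality and the blocks -/

section Restrict

variable {Q₁ Q₂}

/-- An element of `S(H₁ ⊕ H₂)(ℚ)` commutes with the Hodge idempotent `inl ∘ fst` (it lies in `C(H₁ ⊕ H₂)`).
[cite: Moonen2004MT, §4 Lemma 4.6] [cite: Milne1999LefschetzClasses, §1 Prop. 1.5] -/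
theorem Polarization.inl_fst_apply_eq_of_mem_lefschetzGroup_prod {g : (V₁ × V₂) ≃ₗ[ℚ] (V₁ × V₂)}
    (hg : g ∈ (Q₁.prod Q₂).lefschetzGroup) (x : V₁ × V₂) :
    LinearMap.inl ℚ V₁ V₂ (LinearMap.fst ℚ V₁ V₂ (g x)) = g (LinearMap.inl ℚ V₁ V₂ (LinearMap.fst ℚ V₁ V₂ x)) := by
  have hc := (forall_endAlg_apply_iff_coe_mem_centralizer_endAlg (H₁.prod H₂) g).1 hg.1
  exact inl_fst_apply_eq_of_mem_centralizer_endAlg_prod hc x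

/-- The same for `inr ∘ snd`. [cite: Moonen2004MT, §4 Lemma 4.6] [cite: Milne1999LefschetzClasses, §1 Prop. 1.5] -/
theorem Polarization.inr_snd_apply_eq_of_mem_lefschetzGroup_prod {g : (V₁ × V₂) ≃ₗ[ℚ] (V₁ × V₂)}
    (hg : g ∈ (Q₁.prod Q₂).lefschetzGroup) (x : V₁ × V₂) :
    LinearMap.inr ℚ V₁ V₂ (LinearMap.snd ℚ V₁ V₂ (g x)) = g (LinearMap.inr ℚ V₁ V₂ (LinearMap.snd ℚ V₁ V₂ x)) := by
  have hc := (forall_endAlg_apply_iff_coe_mem_centralizer_endAlg (H₁.prod H₂) g).1 hg.1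
  exact inr_snd_apply_eq_of_mem_centralizer_endAlg_prod hc x

/-- **The first block `g₁ = fst ∘ g ∘ inl` of `g ∈ S(H₁ ⊕ H₂)(ℚ)` lies in `S(H₁)(ℚ)`** (as the automorphism
`restrictRetract inl fst g` of the tree): it commutes with `E_φ(H₁)` (g18-#3) and preserves `Q₁` because `g (v, 0) = (g₁ v, 0)`.
[cite: Milne1999LefschetzClasses, §1 Prop. 1.5 (p. 644)] -/
theorem Polarization.restrictRetract_inl_fst_mem_lefschetzGroup {g : (V₁ × V₂) ≃ₗ[ℚ] (V₁ × V₂)}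
    (hg : g ∈ (Q₁.prod Q₂).lefschetzGroup) :
    restrictRetract (LinearMap.inl ℚ V₁ V₂) (LinearMap.fst ℚ V₁ V₂) (fun _ ↦ rfl) g
        (Polarization.inl_fst_apply_eq_of_mem_lefschetzGroup_prod hg) ∈ Q₁.lefschetzGroup := by
  have hc := (forall_endAlg_apply_iff_coe_mem_centralizer_endAlg (H₁.prod H₂) g).1 hg.1
  rw [Polarization.mem_lefschetzGroup_iff, forall_endAlg_apply_iff_coe_mem_centralizer_endAlg H₁, coe_restrictRetract]
  refine ⟨fst_comp_comp_inl_mem_centralizer_endAlg hc, fun v v' ↦ ?_⟩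
  -- `g (inl v) = inl (g₁ v)` by block-diagonality, then `Q₁(g₁ v, g₁ v') = (Q₁ ⊕ Q₂)(g (inl v), g (inl v')) = Q₁(v, v')`
  have hgv : ∀ u : V₁, g (LinearMap.inl ℚ V₁ V₂ u) = LinearMap.inl ℚ V₁ V₂ (g (LinearMap.inl ℚ V₁ V₂ u)).1 := fun u ↦ by
    ext
    · simp
    · simpa using snd_apply_inl_eq_zero_of_mem_centralizer_endAlg_prod hc u
  have h := hg.2 (LinearMap.inl ℚ V₁ V₂ v) (LinearMap.inl ℚ V₁ V₂ v')
  rw [hgv v, hgv v'] at h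
  simpa [Polarization.prod_form_apply, restrictRetract_apply] using h

/-- **The second block `g₂ = snd ∘ g ∘ inr` of `g ∈ S(H₁ ⊕ H₂)(ℚ)` lies in `S(H₂)(ℚ)`.** [cite: Milne1999LefschetzClasses, §1 Prop. 1.5 (p. 644)] -/
theorem Polarization.restrictRetract_inr_snd_mem_lefschetzGroup {g : (V₁ × V₂) ≃ₗ[ℚ] (V₁ × V₂)}
    (hg : g ∈ (Q₁.prod Q₂).lefschetzGroup) :
    restrictRetract (LinearMap.inr ℚ V₁ V₂) (LinearMap.snd ℚ V₁ V₂) (fun _ ↦ rfl) g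
        (Polarization.inr_snd_apply_eq_of_mem_lefschetzGroup_prod hg) ∈ Q₂.lefschetzGroup := by
  have hc := (forall_endAlg_apply_iff_coe_mem_centralizer_endAlg (H₁.prod H₂) g).1 hg.1
  rw [Polarization.mem_lefschetzGroup_iff, forall_endAlg_apply_iff_coe_mem_centralizer_endAlg H₂, coe_restrictRetract]
  refine ⟨snd_comp_comp_inr_mem_centralizer_endAlg hc, fun w w' ↦ ?_⟩
  have hgw : ∀ u : V₂, g (LinearMap.inr ℚ V₁ V₂ u) = LinearMap.inr ℚ V₁ V₂ (g (LinearMap.inr ℚ V₁ V₂ u)).2 := fun u ↦ by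
    ext
    · simpa using fst_apply_inr_eq_zero_of_mem_centralizer_endAlg_prod hc u
    · simp
  have h := hg.2 (LinearMap.inr ℚ V₁ V₂ w) (LinearMap.inr ℚ V₁ V₂ w')
  rw [hgw w, hgw w'] at h
  simpa [Polarization.prod_form_apply, restrictRetract_apply] using h

/-- **`g ∈ S(H₁ ⊕ H₂)(ℚ)` is block diagonal**: `g = (g₁, g₂)` with `gᵢ` its restrictions to the summands.
[cite: Milne1999LefschetzClasses, §1 Prop. 1.5 (p. 644)] [cite: Moonen2004MT, §4 Lemma 4.6] -/
theorem Polarization.eq_prodCongr_restrictRetract_of_mem_lefschetzGroup_prod {g : (V₁ × V₂) ≃ₗ[ℚ] (V₁ × V₂)}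
    (hg : g ∈ (Q₁.prod Q₂).lefschetzGroup) :
    g = (restrictRetract (LinearMap.inl ℚ V₁ V₂) (LinearMap.fst ℚ V₁ V₂) (fun _ ↦ rfl) g
        (Polarization.inl_fst_apply_eq_of_mem_lefschetzGroup_prod hg)).prodCongr
      (restrictRetract (LinearMap.inr ℚ V₁ V₂) (LinearMap.snd ℚ V₁ V₂) (fun _ ↦ rfl) g
        (Polarization.inr_snd_apply_eq_of_mem_lefschetzGroup_prod hg)) := by
  have hc := (forall_endAlg_apply_iff_coe_mem_centralizer_endAlg (H₁.prod H₂) g).1 hg.1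
  refine LinearEquiv.ext fun x ↦ ?_
  have h := LinearMap.congr_fun (eq_prodMap_of_mem_centralizer_endAlg_prod hc) x
  rw [LinearEquiv.coe_coe] at h
  rw [h, LinearMap.prodMap_apply, LinearEquiv.prodCongr_apply]
  rfl

/-- **`S(H₁ ⊕ H₂)(ℚ) ⊆ S(H₁)(ℚ) × S(H₂)(ℚ)`**: every `g ∈ S(H₁ ⊕ H₂)(ℚ)` is `g₁ ⊕ g₂` with `gᵢ ∈ S(Hᵢ)(ℚ)`.
[cite: Milne1999LefschetzClasses, §1 Prop. 1.5 (p. 644)] -/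
theorem Polarization.exists_prodCongr_eq_of_mem_lefschetzGroup_prod {g : (V₁ × V₂) ≃ₗ[ℚ] (V₁ × V₂)}
    (hg : g ∈ (Q₁.prod Q₂).lefschetzGroup) :
    ∃ g₁ ∈ Q₁.lefschetzGroup, ∃ g₂ ∈ Q₂.lefschetzGroup, g = g₁.prodCongr g₂ :=
  ⟨_, Polarization.restrictRetract_inl_fst_mem_lefschetzGroup hg, _, Polarization.restrictRetract_inr_snd_mem_lefschetzGroup hg,
    Polarization.eq_prodCongr_restrictRetract_of_mem_lefschetzGroup_prod hg⟩

variable (Q₁ Q₂) in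
/-- Membership in `S(H₁ ⊕ H₂)(ℚ)`, fully described: `g ∈ S(H₁ ⊕ H₂)(ℚ)` iff `g = g₁ ⊕ g₂` with `gᵢ ∈ S(Hᵢ)(ℚ)` intertwining all
morphisms between the summands. [cite: Milne1999LefschetzClasses, §1 Prop. 1.5 (p. 644) and Prop. 1.1] -/
theorem Polarization.mem_lefschetzGroup_prod_iff (g : (V₁ × V₂) ≃ₗ[ℚ] (V₁ × V₂)) :
    g ∈ (Q₁.prod Q₂).lefschetzGroup ↔
      ∃ g₁ ∈ Q₁.lefschetzGroup, ∃ g₂ ∈ Q₂.lefschetzGroup, g = g₁.prodCongr g₂ ∧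
        (∀ f : Hom H₁ H₂, (g₂ : Module.End ℚ V₂) ∘ₗ f.toLinearMap = f.toLinearMap ∘ₗ (g₁ : Module.End ℚ V₁)) ∧
          ∀ g' : Hom H₂ H₁, (g₁ : Module.End ℚ V₁) ∘ₗ g'.toLinearMap = g'.toLinearMap ∘ₗ (g₂ : Module.End ℚ V₂) := by
  constructor
  · intro hg
    obtain ⟨g₁, -, g₂, -, rfl⟩ := Polarization.exists_prodCongr_eq_of_mem_lefschetzGroup_prod hg
    obtain ⟨h₁, h₂, hf, hg'⟩ := (Q₁.prodCongr_mem_lefschetzGroup_prod_iff Q₂ g₁ g₂).1 hg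
    exact ⟨g₁, h₁, g₂, h₂, rfl, hf, hg'⟩
  · rintro ⟨g₁, h₁, g₂, h₂, rfl, hf, hg'⟩
    exact (Q₁.prodCongr_mem_lefschetzGroup_prod_iff Q₂ g₁ g₂).2 ⟨h₁, h₂, hf, hg'⟩

end Restrict

/-! ## §3 Proposition 1.5: `S(H₁)(ℚ) × S(H₂)(ℚ) ≅ S(H₁ ⊕ H₂)(ℚ)` iff `Hom(H₁, H₂) = 0 = Hom(H₂, H₁)` -/

section PropOneFive

omit Q₁ Q₂ in
/-- In a `ℚ`-vector space `-x = x` forces `x = 0`. Private plumbing. [folklore] -/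
private theorem eq_zero_of_neg_eq_self' {W : Type*} [AddCommGroup W] [Module ℚ W] {x : W} (h : -x = x) : x = 0 := by
  have h2 : (2 : ℚ) • x = 0 := by
    rw [two_smul]
    nth_rw 1 [← h]
    exact neg_add_cancel x
  exact (smul_eq_zero.1 h2).resolve_left (by norm_num)

omit Q₁ Q₂ in
/-- `-id ∈ S(H)(ℚ)` (it commutes with everything and preserves every bilinear form); `-id` is Mathlib's `LinearEquiv.neg ℚ`.
[cite: Milne1999LefschetzClasses, §1 p. 644 (S(A))] -/
theorem Polarization.neg_mem_lefschetzGroup {V : Type u} [AddCommGroup V] [Module ℚ V] {H : HodgeStructure V n}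
    (Q : Polarization H) : LinearEquiv.neg ℚ ∈ Q.lefschetzGroup := by
  refine ⟨fun a v ↦ ?_, fun v w ↦ ?_⟩
  · rw [LinearEquiv.neg_apply, LinearEquiv.neg_apply, map_neg]
  · rw [LinearEquiv.neg_apply, LinearEquiv.neg_apply, map_neg, map_neg, LinearMap.neg_apply, neg_neg]

/-- **Proposition 1.5 for `s = 2`: "`S(A₁) × S(A₂) → S(A)` is an isomorphism" exactly when there are no morphisms between the
summands** (Milne: representatives of distinct simple isogeny classes): `g₁ ⊕ g₂ ∈ S(H₁ ⊕ H₂)(ℚ)` for ALL `gᵢ ∈ S(Hᵢ)(ℚ)` iff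
`Hom(H₁, H₂) = 0` and `Hom(H₂, H₁) = 0` ("⟹": `(1, -1) ∈ S(H₁)(ℚ) × S(H₂)(ℚ)` intertwines `f` only if `-f = f`).
[cite: Milne1999LefschetzClasses, §1 Prop. 1.5 (p. 644)] -/
theorem Polarization.forall_prodCongr_mem_lefschetzGroup_prod_iff :
    (∀ g₁ ∈ Q₁.lefschetzGroup, ∀ g₂ ∈ Q₂.lefschetzGroup, g₁.prodCongr g₂ ∈ (Q₁.prod Q₂).lefschetzGroup) ↔
      (∀ f : Hom H₁ H₂, f.toLinearMap = 0) ∧ ∀ g : Hom H₂ H₁, g.toLinearMap = 0 := by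
  constructor
  · intro h
    have h1 := (Q₁.prodCongr_mem_lefschetzGroup_prod_iff Q₂ 1 (LinearEquiv.neg ℚ)).1
      (h 1 (Subgroup.one_mem _) (LinearEquiv.neg ℚ) Q₂.neg_mem_lefschetzGroup)
    refine ⟨fun f ↦ LinearMap.ext fun v ↦ ?_, fun g ↦ LinearMap.ext fun w ↦ ?_⟩
    · -- `-(f v) = f v`
      have hf := LinearMap.congr_fun (h1.2.2.1 f) v
      simp only [LinearMap.coe_comp, Function.comp_apply, LinearEquiv.coe_coe, LinearEquiv.neg_apply] at hf
      rw [LinearMap.zero_apply]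
      exact eq_zero_of_neg_eq_self' hf
    · -- `g w = g (-w) = -(g w)`
      have hg := LinearMap.congr_fun (h1.2.2.2 g) w
      simp only [LinearMap.coe_comp, Function.comp_apply, LinearEquiv.coe_coe, LinearEquiv.neg_apply, map_neg] at hg
      rw [LinearMap.zero_apply]
      exact eq_zero_of_neg_eq_self' hg.symm
  · rintro ⟨hf, hg⟩ g₁ h₁ g₂ h₂
    exact (Q₁.prodCongr_mem_lefschetzGroup_prod_iff Q₂ g₁ g₂).2
      ⟨h₁, h₂, fun f ↦ by rw [hf f, LinearMap.comp_zero, LinearMap.zero_comp],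
        fun g ↦ by rw [hg g, LinearMap.comp_zero, LinearMap.zero_comp]⟩

/-- **`S(H₁ ⊕ H₂)(ℚ) = S(H₁)(ℚ) × S(H₂)(ℚ)` when `Hom(H₁, H₂) = 0 = Hom(H₂, H₁)`**: `g ∈ S(H₁ ⊕ H₂)(ℚ)` iff `g = g₁ ⊕ g₂` with
`gᵢ ∈ S(Hᵢ)(ℚ)`. [cite: Milne1999LefschetzClasses, §1 Prop. 1.5 (p. 644)] -/
theorem Polarization.mem_lefschetzGroup_prod_iff_of_hom_eq_zero (hf : ∀ f : Hom H₁ H₂, f.toLinearMap = 0)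
    (hg : ∀ g : Hom H₂ H₁, g.toLinearMap = 0) (g : (V₁ × V₂) ≃ₗ[ℚ] (V₁ × V₂)) :
    g ∈ (Q₁.prod Q₂).lefschetzGroup ↔ ∃ g₁ ∈ Q₁.lefschetzGroup, ∃ g₂ ∈ Q₂.lefschetzGroup, g = g₁.prodCongr g₂ := by
  refine ⟨Polarization.exists_prodCongr_eq_of_mem_lefschetzGroup_prod, ?_⟩
  rintro ⟨g₁, h₁, g₂, h₂, rfl⟩
  exact (Q₁.forall_prodCongr_mem_lefschetzGroup_prod_iff Q₂).2 ⟨hf, hg⟩ g₁ h₁ g₂ h₂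

omit Q₁ Q₂ in
/-- `(g₁, g₂) ↦ g₁ ⊕ g₂` is injective on `GL(V₁) × GL(V₂)` — with the previous theorem, the bijectivity of Proposition 1.5's map
`S(A₁) × S(A₂) → S(A)` (`s = 2`). [cite: Milne1999LefschetzClasses, §1 Prop. 1.5 (p. 644)] -/
theorem prodCongr_injective :
    Function.Injective (fun p : (V₁ ≃ₗ[ℚ] V₁) × (V₂ ≃ₗ[ℚ] V₂) ↦ p.1.prodCongr p.2) := by
  rintro ⟨g₁, g₂⟩ ⟨g₁', g₂'⟩ h
  have h1 : g₁ = g₁' := by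
    refine LinearEquiv.ext fun v ↦ ?_
    simpa [LinearEquiv.prodCongr_apply] using congrArg Prod.fst (LinearEquiv.congr_fun h (v, 0))
  have h2 : g₂ = g₂' := by
    refine LinearEquiv.ext fun w ↦ ?_
    simpa [LinearEquiv.prodCongr_apply] using congrArg Prod.snd (LinearEquiv.congr_fun h (0, w))
  rw [h1, h2]

end PropOneFive

/-! ## §4 Powers: "It follows from Proposition 1.5 that `S(A) = S(A^r)`" (`r = 2`) -/

section Powers

variable {V : Type u} [AddCommGroup V] [Module ℚ V] {H : HodgeStructure V n} (Q : Polarization H)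

/-- **`(g₁, g₂) ∈ S(H ⊕ H)(ℚ) ⟺ g₁ = g₂ ∈ S(H)(ℚ)`** (intertwining with `id : H → H`). [cite: Milne1999LefschetzClasses, §3 p. 654 ("S(A) = S(A^r)") and §1 Prop. 1.5] -/
theorem Polarization.prodCongr_mem_lefschetzGroup_prod_self_iff (g₁ g₂ : V ≃ₗ[ℚ] V) :
    g₁.prodCongr g₂ ∈ (Q.prod Q).lefschetzGroup ↔ g₁ ∈ Q.lefschetzGroup ∧ g₂ = g₁ := by
  rw [Q.prodCongr_mem_lefschetzGroup_prod_iff Q]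
  constructor
  · rintro ⟨h₁, -, hf, -⟩
    have h := hf (Hom.id H)
    change (g₂ : Module.End ℚ V) ∘ₗ LinearMap.id = LinearMap.id ∘ₗ (g₁ : Module.End ℚ V) at h
    rw [LinearMap.comp_id, LinearMap.id_comp] at h
    exact ⟨h₁, LinearEquiv.toLinearMap_injective h⟩
  · rintro ⟨h₁, rfl⟩
    have hc := (forall_endAlg_apply_iff_coe_mem_centralizer_endAlg H g₂).1 h₁.1
    exact ⟨h₁, h₁, fun f ↦ ((Subalgebra.mem_centralizer_iff ℚ).1 hc _ (Hom.toLinearMap_mem_endAlg f)).symm,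
      fun g ↦ ((Subalgebra.mem_centralizer_iff ℚ).1 hc _ (Hom.toLinearMap_mem_endAlg g)).symm⟩

/-- **"`S(A) = S(A^r)`"** (`r = 2`, the diagonal action): `g ∈ S(H ⊕ H)(ℚ)` iff `g = g₀ ⊕ g₀` for some `g₀ ∈ S(H)(ℚ)`.
[cite: Milne1999LefschetzClasses, §3 p. 654 ("It follows from Proposition 1.5 that S(A) = S(A^r)")] -/
theorem Polarization.mem_lefschetzGroup_prod_self_iff (g : (V × V) ≃ₗ[ℚ] (V × V)) :
    g ∈ (Q.prod Q).lefschetzGroup ↔ ∃ g₀ ∈ Q.lefschetzGroup, g = g₀.prodCongr g₀ := by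
  constructor
  · intro hg
    obtain ⟨g₁, -, g₂, -, heq⟩ := Polarization.exists_prodCongr_eq_of_mem_lefschetzGroup_prod hg
    rw [heq] at hg
    obtain ⟨h₁, h₂⟩ := (Q.prodCongr_mem_lefschetzGroup_prod_self_iff g₁ g₂).1 hg
    exact ⟨g₁, h₁, heq.trans (by rw [h₂])⟩
  · rintro ⟨g₀, h₀, rfl⟩
    exact (Q.prodCongr_mem_lefschetzGroup_prod_self_iff g₀ g₀).2 ⟨h₀, rfl⟩

end Powers

end HodgeStructure

end Literature.AlgebraicGeometry.Motives
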